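import Literature.AlgebraicGeometry.HodgeTheory.RibetTypeFortyOnefoldMinimalRankCellsPowersHodgeClasses
import Literature.AlgebraicGeometry.Motives.HodgeThetaSubalgebraUnitarySeventeenTwentyFourCore
import Literature.AlgebraicGeometry.Motives.HodgeThetaSubalgebraUnitaryNineteenTwentyTwoCore
import HarnessLib

/-!
# Hodge classes on all powers of abelian varieties of Ribet type `(17, 24)` and `(19, 22)` are generated by divisor classes
# (Ribet 1983 Thm. 3 at these multiplicities, by the MINIMAL-RANK method — UNCONDITIONAL); the third census of
# SIMPLE ABELIAN 41-FOLDS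

Family `hodge`, layer `Literature/AlgebraicGeometry/HodgeTheory`. Research context: cell `pub-hodge-ring2` (HONEST
FRAMING: research route conditional on HC_CM; not a corollary; Q11.4-sentence-2 already refuted in dim ≥ 3),
Literature lane gen 88. UNCONDITIONAL for the class of abelian varieties it names; theorems only, no definition, no
named fact (D-0026), no `sorry`. The CELLS of the generic assembly `RibetTypeOfCoreSmulPowersHodgeClasses` at the
minimal-rank cores `UnitarySeventeenTwentyFour`, `UnitaryNineteenTwentyTwo.eq_top_of_smul` (coprime multiplicities with BAD raising
ranks, settled rank by rank: a full small Levi algebra and lifts killed in the large one, two pencils, exclusive Levi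
profiles, and — where needed — TOOL C, the orthogonal-chain count `UnitaryOrthogonalChain.false_of_constProfile` or a
constant-rank sub-Levi lemma for the constant profiles), and the refinement of the census
`isDivisorGenerated_powSucc_of_isSimple_fortyonefold'` they give: the residual `k`-signatures of a simple `41`-fold with an imaginary quadratic `End⁰` are now
`{15, 26}`, `{16, 25}`, `{20, 21}`.

THE PRINTED THEOREM. Ribet, Amer. J. Math. 105 (1983), Thm. 3 = Gordon's survey Thm. 6.3 (3) [held
`paper:arxiv-alg-geom_9709030` p. 18]: for an abelian variety `A` with `End⁰(A)` an imaginary quadratic field acting with coprime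
multiplicities `(n′, n″)`, the Hodge ring of every power of `A` is generated by divisors.

* §1 the cells `(17, 24)` and `(19, 22)` (and mirrors), the Hodge conjecture for these powers, 41-FOLDS of these signatures.
* §2 `isDivisorGenerated_powSucc_of_isSimple_fortyonefold''`: `B• = D•` on all powers of a simple `41`-fold granted only `End⁰ = ℚ` and the
  `k`-signatures `{15, 26}`, `{16, 25}`, `{20, 21}`.

## References
* [Ribet1983] K. A. Ribet, Amer. J. Math. 105 (1983), Thm. 0 and Thm. 3.
* [Gordon1997] B. B. Gordon, *A survey of the Hodge conjecture for abelian varieties*, Thm. 6.3 (3) and Corollary.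
* [MoonenZarhin1999LowDim] B. Moonen, Yu. Zarhin, Math. Ann. 315 (1999), §2 (2.4), Thm. (2.7).
* [Deligne2000] P. Deligne, *The Hodge conjecture* (Clay, 2000), §1.
-/

noncomputable section

open CategoryTheory Module

namespace Literature.AlgebraicGeometry.HodgeTheory

open Literature.AlgebraicGeometry.Motives
open Literature.AlgebraicGeometry.Motives.HodgeStructure

section Cells

/-- **Ribet 1983 Thm. 3 at `(n′, n″) = (17, 24)` — UNCONDITIONAL** (core `UnitarySeventeenTwentyFour.eq_top_of_smul`).
[cite: Ribet1983, Thm. 0 and Thm. 3] [cite: Gordon1997, Thm. 6.3 (3) and Corollary] -/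
theorem AbelianVariety.isDivisorGenerated_powSucc_of_ribetTypeSeventeenTwentyFour (A : AbelianVariety ℂ) (φ : A ⟶ A)
    {d : ℕ} (hd : 0 < d) (hφ : φ ≫ φ = -(d • 𝟙 A)) (hE2 : Module.finrank ℚ A.endAlgebra = 2)
    (h17 : eigenMultiplicity A φ (Complex.I * (Real.sqrt d : ℂ)) = 17)
    (h24 : eigenMultiplicity A φ (-(Complex.I * (Real.sqrt d : ℂ))) = 24) (N : ℕ) :
    IsDivisorGenerated (A.powSucc N) := by
  refine AbelianVariety.isDivisorGenerated_powSucc_of_ribetType_ofCoreSmul A φ hd hφ hE2 (by omega) (by omega) ?_ N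
  intro W' _ _ _ 𝔊 ι P' Q' s hbr hirr hι hιι hP' hQ' hfinP' hfinQ' hadd hsmul hsymm hPQ hdefP hdefQ hadj
  exact UnitarySeventeenTwentyFour.eq_top_of_smul hbr hirr hι hιι hP' hQ' (by rw [hfinP', h17]) (by rw [hfinQ', h24]) hadd
    hsmul hsymm hPQ hdefP hdefQ hadj

/-- The mirror: `n_{i√d}(φ) = 24`, `n_{−i√d}(φ) = 17` (core `UnitarySeventeenTwentyFour.eq_top_of_smul'`).
[cite: Ribet1983, Thm. 0 and Thm. 3] [cite: Gordon1997, Thm. 6.3 (3) and Corollary] -/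
theorem AbelianVariety.isDivisorGenerated_powSucc_of_ribetTypeSeventeenTwentyFour' (A : AbelianVariety ℂ) (φ : A ⟶ A)
    {d : ℕ} (hd : 0 < d) (hφ : φ ≫ φ = -(d • 𝟙 A)) (hE2 : Module.finrank ℚ A.endAlgebra = 2)
    (h24 : eigenMultiplicity A φ (Complex.I * (Real.sqrt d : ℂ)) = 24)
    (h17 : eigenMultiplicity A φ (-(Complex.I * (Real.sqrt d : ℂ))) = 17) (N : ℕ) :
    IsDivisorGenerated (A.powSucc N) := by
  refine AbelianVariety.isDivisorGenerated_powSucc_of_ribetType_ofCoreSmul A φ hd hφ hE2 (by omega) (by omega) ?_ N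
  intro W' _ _ _ 𝔊 ι P' Q' s hbr hirr hι hιι hP' hQ' hfinP' hfinQ' hadd hsmul hsymm hPQ hdefP hdefQ hadj
  exact UnitarySeventeenTwentyFour.eq_top_of_smul' hbr hirr hι hιι hP' hQ' (by rw [hfinP', h24]) (by rw [hfinQ', h17])
    hadd hsmul hsymm hPQ hdefP hdefQ hadj

/-- **The Hodge conjecture for all powers `A^{N+1}` of an abelian variety of Ribet type `(17, 24)` — UNCONDITIONAL.**
[cite: Ribet1983, Thm. 3] [cite: Deligne2000, §1] -/
theorem hodgeConjectureFor_powSucc_of_ribetTypeSeventeenTwentyFour (A : AbelianVariety ℂ) (φ : A ⟶ A)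
    {d : ℕ} (hd : 0 < d) (hφ : φ ≫ φ = -(d • 𝟙 A)) (hE2 : Module.finrank ℚ A.endAlgebra = 2)
    (h17 : eigenMultiplicity A φ (Complex.I * (Real.sqrt d : ℂ)) = 17)
    (h24 : eigenMultiplicity A φ (-(Complex.I * (Real.sqrt d : ℂ))) = 24) (N : ℕ) :
    HodgeConjectureFor (A.powSucc N).dim (A.powSucc N).X :=
  hodgeConjectureFor_of_isDivisorGenerated _
    (AbelianVariety.isDivisorGenerated_powSucc_of_ribetTypeSeventeenTwentyFour A φ hd hφ hE2 h17 h24 N)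

/-- **41-FOLDS of signature `{17, 24}`: `B• = D•` on all powers — UNCONDITIONAL** (either eigenvalue may carry the `17`).
[cite: Ribet1983, Thm. 0 and Thm. 3] [cite: MoonenZarhin1999LowDim, §2 (2.4)] -/
theorem AbelianVariety.isDivisorGenerated_powSucc_of_fortyonefold_seventeenTwentyFour (A : AbelianVariety ℂ)
    (φ : A ⟶ A) {d : ℕ} (hd : 0 < d) (hφ : φ ≫ φ = -(d • 𝟙 A)) (hE2 : Module.finrank ℚ A.endAlgebra = 2)
    (hX : A.dim = 41)
    (h17 : eigenMultiplicity A φ (Complex.I * (Real.sqrt d : ℂ)) = 17 ∨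
      eigenMultiplicity A φ (-(Complex.I * (Real.sqrt d : ℂ))) = 17)
    (N : ℕ) : IsDivisorGenerated (A.powSucc N) := by
  have hsum := eigenMultiplicity_add_eigenMultiplicity_neg_eq_dim A φ hd hφ
  rw [hX] at hsum
  rcases h17 with h | h
  · exact AbelianVariety.isDivisorGenerated_powSucc_of_ribetTypeSeventeenTwentyFour A φ hd hφ hE2 h (by omega) N
  · exact AbelianVariety.isDivisorGenerated_powSucc_of_ribetTypeSeventeenTwentyFour' A φ hd hφ hE2 (by omega) h N

/-- **The Hodge conjecture for all powers of a 41-FOLD of signature `{17, 24}` — UNCONDITIONAL.**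
[cite: Ribet1983, Thm. 3] [cite: Deligne2000, §1] -/
theorem hodgeConjectureFor_powSucc_of_fortyonefold_seventeenTwentyFour (A : AbelianVariety ℂ)
    (φ : A ⟶ A) {d : ℕ} (hd : 0 < d) (hφ : φ ≫ φ = -(d • 𝟙 A)) (hE2 : Module.finrank ℚ A.endAlgebra = 2)
    (hX : A.dim = 41)
    (h17 : eigenMultiplicity A φ (Complex.I * (Real.sqrt d : ℂ)) = 17 ∨
      eigenMultiplicity A φ (-(Complex.I * (Real.sqrt d : ℂ))) = 17)
    (N : ℕ) : HodgeConjectureFor (A.powSucc N).dim (A.powSucc N).X :=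
  hodgeConjectureFor_of_isDivisorGenerated _
    (AbelianVariety.isDivisorGenerated_powSucc_of_fortyonefold_seventeenTwentyFour A φ hd hφ hE2 hX h17 N)

/-- **Ribet 1983 Thm. 3 at `(n′, n″) = (19, 22)` — UNCONDITIONAL** (core `UnitaryNineteenTwentyTwo.eq_top_of_smul`).
[cite: Ribet1983, Thm. 0 and Thm. 3] [cite: Gordon1997, Thm. 6.3 (3) and Corollary] -/
theorem AbelianVariety.isDivisorGenerated_powSucc_of_ribetTypeNineteenTwentyTwo (A : AbelianVariety ℂ) (φ : A ⟶ A)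
    {d : ℕ} (hd : 0 < d) (hφ : φ ≫ φ = -(d • 𝟙 A)) (hE2 : Module.finrank ℚ A.endAlgebra = 2)
    (h19 : eigenMultiplicity A φ (Complex.I * (Real.sqrt d : ℂ)) = 19)
    (h22 : eigenMultiplicity A φ (-(Complex.I * (Real.sqrt d : ℂ))) = 22) (N : ℕ) :
    IsDivisorGenerated (A.powSucc N) := by
  refine AbelianVariety.isDivisorGenerated_powSucc_of_ribetType_ofCoreSmul A φ hd hφ hE2 (by omega) (by omega) ?_ N
  intro W' _ _ _ 𝔊 ι P' Q' s hbr hirr hι hιι hP' hQ' hfinP' hfinQ' hadd hsmul hsymm hPQ hdefP hdefQ hadj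
  exact UnitaryNineteenTwentyTwo.eq_top_of_smul hbr hirr hι hιι hP' hQ' (by rw [hfinP', h19]) (by rw [hfinQ', h22]) hadd
    hsmul hsymm hPQ hdefP hdefQ hadj

/-- The mirror: `n_{i√d}(φ) = 22`, `n_{−i√d}(φ) = 19` (core `UnitaryNineteenTwentyTwo.eq_top_of_smul'`).
[cite: Ribet1983, Thm. 0 and Thm. 3] [cite: Gordon1997, Thm. 6.3 (3) and Corollary] -/
theorem AbelianVariety.isDivisorGenerated_powSucc_of_ribetTypeNineteenTwentyTwo' (A : AbelianVariety ℂ) (φ : A ⟶ A)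
    {d : ℕ} (hd : 0 < d) (hφ : φ ≫ φ = -(d • 𝟙 A)) (hE2 : Module.finrank ℚ A.endAlgebra = 2)
    (h22 : eigenMultiplicity A φ (Complex.I * (Real.sqrt d : ℂ)) = 22)
    (h19 : eigenMultiplicity A φ (-(Complex.I * (Real.sqrt d : ℂ))) = 19) (N : ℕ) :
    IsDivisorGenerated (A.powSucc N) := by
  refine AbelianVariety.isDivisorGenerated_powSucc_of_ribetType_ofCoreSmul A φ hd hφ hE2 (by omega) (by omega) ?_ N
  intro W' _ _ _ 𝔊 ι P' Q' s hbr hirr hι hιι hP' hQ' hfinP' hfinQ' hadd hsmul hsymm hPQ hdefP hdefQ hadj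
  exact UnitaryNineteenTwentyTwo.eq_top_of_smul' hbr hirr hι hιι hP' hQ' (by rw [hfinP', h22]) (by rw [hfinQ', h19])
    hadd hsmul hsymm hPQ hdefP hdefQ hadj

/-- **The Hodge conjecture for all powers `A^{N+1}` of an abelian variety of Ribet type `(19, 22)` — UNCONDITIONAL.**
[cite: Ribet1983, Thm. 3] [cite: Deligne2000, §1] -/
theorem hodgeConjectureFor_powSucc_of_ribetTypeNineteenTwentyTwo (A : AbelianVariety ℂ) (φ : A ⟶ A)
    {d : ℕ} (hd : 0 < d) (hφ : φ ≫ φ = -(d • 𝟙 A)) (hE2 : Module.finrank ℚ A.endAlgebra = 2)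
    (h19 : eigenMultiplicity A φ (Complex.I * (Real.sqrt d : ℂ)) = 19)
    (h22 : eigenMultiplicity A φ (-(Complex.I * (Real.sqrt d : ℂ))) = 22) (N : ℕ) :
    HodgeConjectureFor (A.powSucc N).dim (A.powSucc N).X :=
  hodgeConjectureFor_of_isDivisorGenerated _
    (AbelianVariety.isDivisorGenerated_powSucc_of_ribetTypeNineteenTwentyTwo A φ hd hφ hE2 h19 h22 N)

/-- **41-FOLDS of signature `{19, 22}`: `B• = D•` on all powers — UNCONDITIONAL** (either eigenvalue may carry the `19`).
[cite: Ribet1983, Thm. 0 and Thm. 3] [cite: MoonenZarhin1999LowDim, §2 (2.4)] -/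
theorem AbelianVariety.isDivisorGenerated_powSucc_of_fortyonefold_nineteenTwentyTwo (A : AbelianVariety ℂ)
    (φ : A ⟶ A) {d : ℕ} (hd : 0 < d) (hφ : φ ≫ φ = -(d • 𝟙 A)) (hE2 : Module.finrank ℚ A.endAlgebra = 2)
    (hX : A.dim = 41)
    (h19 : eigenMultiplicity A φ (Complex.I * (Real.sqrt d : ℂ)) = 19 ∨
      eigenMultiplicity A φ (-(Complex.I * (Real.sqrt d : ℂ))) = 19)
    (N : ℕ) : IsDivisorGenerated (A.powSucc N) := by
  have hsum := eigenMultiplicity_add_eigenMultiplicity_neg_eq_dim A φ hd hφ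
  rw [hX] at hsum
  rcases h19 with h | h
  · exact AbelianVariety.isDivisorGenerated_powSucc_of_ribetTypeNineteenTwentyTwo A φ hd hφ hE2 h (by omega) N
  · exact AbelianVariety.isDivisorGenerated_powSucc_of_ribetTypeNineteenTwentyTwo' A φ hd hφ hE2 (by omega) h N

/-- **The Hodge conjecture for all powers of a 41-FOLD of signature `{19, 22}` — UNCONDITIONAL.**
[cite: Ribet1983, Thm. 3] [cite: Deligne2000, §1] -/
theorem hodgeConjectureFor_powSucc_of_fortyonefold_nineteenTwentyTwo (A : AbelianVariety ℂ)
    (φ : A ⟶ A) {d : ℕ} (hd : 0 < d) (hφ : φ ≫ φ = -(d • 𝟙 A)) (hE2 : Module.finrank ℚ A.endAlgebra = 2)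
    (hX : A.dim = 41)
    (h19 : eigenMultiplicity A φ (Complex.I * (Real.sqrt d : ℂ)) = 19 ∨
      eigenMultiplicity A φ (-(Complex.I * (Real.sqrt d : ℂ))) = 19)
    (N : ℕ) : HodgeConjectureFor (A.powSucc N).dim (A.powSucc N).X :=
  hodgeConjectureFor_of_isDivisorGenerated _
    (AbelianVariety.isDivisorGenerated_powSucc_of_fortyonefold_nineteenTwentyTwo A φ hd hφ hE2 hX h19 N)

end Cells

/-! ### §2 The third 41-fold census -/

section Census

variable {X : AbelianVariety ℂ}

/-- **`B• = D•` on all powers of a SIMPLE complex abelian `41`-FOLD, granted ONLY `End⁰ = ℚ` and the `k`-signatures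
`{15, 26}`, `{16, 25}`, `{20, 21}`** (refines `isDivisorGenerated_powSucc_of_isSimple_fortyonefold'` by the cells `{17, 24}`, `{19, 22}`).
[cite: MoonenZarhin1999LowDim, §2 (2.4) and Thm. (2.7)] [cite: Ribet1983, Thms. 0–3] [cite: Gordon1997, Thm. 6.3 and Corollary] -/
theorem isDivisorGenerated_powSucc_of_isSimple_fortyonefold'' (hs : X.IsSimple) (hX : X.dim = 41)
    (h1 : Module.finrank ℚ X.endAlgebra = 1 → ∀ N : ℕ, IsDivisorGenerated (X.powSucc N))
    (hres : ∀ (φ : X ⟶ X) (d : ℕ), 0 < d → φ ≫ φ = -(d • 𝟙 X) → Module.finrank ℚ X.endAlgebra = 2 →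
      (eigenMultiplicity X φ (Complex.I * (Real.sqrt d : ℂ)) = 15 ∨ eigenMultiplicity X φ (Complex.I * (Real.sqrt d : ℂ)) = 16 ∨ eigenMultiplicity X φ (Complex.I * (Real.sqrt d : ℂ)) = 20 ∨ eigenMultiplicity X φ (Complex.I * (Real.sqrt d : ℂ)) = 21 ∨ eigenMultiplicity X φ (Complex.I * (Real.sqrt d : ℂ)) = 25 ∨ eigenMultiplicity X φ (Complex.I * (Real.sqrt d : ℂ)) = 26) →
      ∀ N : ℕ, IsDivisorGenerated (X.powSucc N))
    (N : ℕ) : IsDivisorGenerated (X.powSucc N) := by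
  refine isDivisorGenerated_powSucc_of_isSimple_fortyonefold' hs hX h1 (fun φ d hd hφ he2 h N => ?_) N
  have hsum := eigenMultiplicity_add_eigenMultiplicity_neg_eq_dim X φ hd hφ
  rw [hX] at hsum
  by_cases h17 : eigenMultiplicity X φ (Complex.I * (Real.sqrt d : ℂ)) = 17 ∨ eigenMultiplicity X φ (-(Complex.I * (Real.sqrt d : ℂ))) = 17
  · exact AbelianVariety.isDivisorGenerated_powSucc_of_fortyonefold_seventeenTwentyFour X φ hd hφ he2 hX h17 N
  by_cases h19 : eigenMultiplicity X φ (Complex.I * (Real.sqrt d : ℂ)) = 19 ∨ eigenMultiplicity X φ (-(Complex.I * (Real.sqrt d : ℂ))) = 19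
  · exact AbelianVariety.isDivisorGenerated_powSucc_of_fortyonefold_nineteenTwentyTwo X φ hd hφ he2 hX h19 N
  exact hres φ d hd hφ he2 (by omega) N

/-- **The Hodge conjecture on all powers of a SIMPLE complex abelian `41`-FOLD, granted ONLY `End⁰ = ℚ` and the
`k`-signatures `{15, 26}`, `{16, 25}`, `{20, 21}`.** [cite: Ribet1983, Thms. 0–3] [cite: Deligne2000, §1] -/
theorem hodgeConjectureFor_powSucc_of_isSimple_fortyonefold'' (hs : X.IsSimple) (hX : X.dim = 41)
    (h1 : Module.finrank ℚ X.endAlgebra = 1 → ∀ N : ℕ, IsDivisorGenerated (X.powSucc N))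
    (hres : ∀ (φ : X ⟶ X) (d : ℕ), 0 < d → φ ≫ φ = -(d • 𝟙 X) → Module.finrank ℚ X.endAlgebra = 2 →
      (eigenMultiplicity X φ (Complex.I * (Real.sqrt d : ℂ)) = 15 ∨ eigenMultiplicity X φ (Complex.I * (Real.sqrt d : ℂ)) = 16 ∨ eigenMultiplicity X φ (Complex.I * (Real.sqrt d : ℂ)) = 20 ∨ eigenMultiplicity X φ (Complex.I * (Real.sqrt d : ℂ)) = 21 ∨ eigenMultiplicity X φ (Complex.I * (Real.sqrt d : ℂ)) = 25 ∨ eigenMultiplicity X φ (Complex.I * (Real.sqrt d : ℂ)) = 26) →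
      ∀ N : ℕ, IsDivisorGenerated (X.powSucc N))
    (N : ℕ) : HodgeConjectureFor (X.powSucc N).dim (X.powSucc N).X :=
  hodgeConjectureFor_of_isDivisorGenerated _ (isDivisorGenerated_powSucc_of_isSimple_fortyonefold'' hs hX h1 hres N)

end Census

end Literature.AlgebraicGeometry.HodgeTheory

end

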